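import Summits.QuantumFields.YangMills.Theorems.BalabanUVNodesN21LowCentreNumeralBlock

/-!
# N21 (NE7c) · THE CAPSTONE OF THE LOW-CENTRE NUMERAL CHAIN: (M1) on the cut law with the block action's analytic
# binders displayed AS [LF-II] §1's PRINTED ROWS BY NAME ((1.2) expansion · (1.6) linear member · (1.9) coercivity)

Width seat pub-ymgap-dag-n21-w1 (g0; director-ym №197 ∕ HUMAN RULING D-0149), node N21 = NE7c (single-run shell-weight
bound, NOT PRINTED in [Bałaban 1983–89], NOT proved), lane K3⁷ `SpineGivenEndpointR13SepCoPH` (stmt-QuantumFields-20544,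
`--kind proof --supports … --as helper`).  Fifth file of the seat's item-1 chain (p583903 → p585816 → p587481 → p589359);
composes BY NAME p587481 §3 ★ `slotAntiConcentration_restrict_of_certifiedLowCentre_defect` (n21-d part 31's END with the
lowness binder discharged by the VALUE-DEFECT certificate) with p587481 §5 ★★ `firstOrderModel_of_sect1Letters` (the
defect model about the background FROM the typed rows `B16Sect1Wilson.Ineq16` ∕ `Ineq19` of [Balaban1989LargeFieldII]
§1) and ★★★ `numeral_at_sect1Letters` (the numeral from ONE clause).  v1.1 (g2, HEADER-ONLY; every declaration
byte-identical): the ledger citation tags of this capstone — [Balaban1989LargeFieldII] §1 ((1.2) p.357, (1.6) p.357, (1.9)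
p.358: the rows entering AS HYPOTHESES `Ineq16`∕`Ineq19`) — recorded at propose time (ref-O READ-78 NIT-1); successors on
the exponential `SU(N)` block chart: `…N21LowCentreEndAtSUNBlockChart` (g2 file 9) ∕ `…Record` (file 10).

WHAT.  ★★★ `slotAntiConcentration_restrict_of_sect1Letters`: in the product frame `X × (κ → ℝ)` (exterior point, block
chart `B′` of (1.2) centred at the background `U₀`, i.e. centre `0`), density `𝟙_{K z}(B′)·e^{−φ_z(B′)}` with kept CONVEX
cuts and a CONVEX exponent `φ_z`, the (M1) bound
`SlotAntiConcentration (ν|({U<θ} ∩ C)) U θ ρ (3(#κ+1)(1+Q)∕(κ₀(1−ρ)))` holds under EXACTLY these displayed binders: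
the expansion identity of (1.2) `φ_z v = φ_z 0 + ½·Q_z v + lin_z v + Vt_z v` on `K z`; the PRINTED ROWS as hypotheses on
the chart — (1.9) `Ineq19 (Q_z v) (Σ_b v_b²) γ₀ d M` («for g_k sufficiently small»), (1.6) `Ineq16 (lin_z v) B₃ M₀ A₀
p₀(g_k) R_k M`; the remainder's value bound `|Vt_z v| ≤ W_V` («O(g_k^{1−β})|Λ|», p.357 prose); the `L`-Lipschitz statistic
with core reading `U(z, 0) ≤ σθ`; the ONE located clause `16·W·d·(100M)^{d+1}·L² ≤ γ₀·(θ(1−ρ−σ))²`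
(`W = 3B₃M₀A₀²p₀(g_k)²e^{−R_k}(100M)⁴ + W_V`; p589359: it holds for g_k small); and part 28's envelope `henv`, radial
transversality `hRT`, odds `hQ`.  §2: its A6 witness — every binder discharged in the kernel, the clause WITH EQUALITY.

HONEST FRAMING.  Composition BY NAME of landed files + [textbook]; 0 def, 0 sorry; the rows `Ineq16`∕`Ineq19` enter as
HYPOTHESES on the chart (their identification with the block action of the N21 slot is this seat's located typing, desk
ME #33∕#34); nothing of Bałaban's asserted; NE7c NOT PRINTED ∕ NOT proved; N21 NOT discharged; counts unmoved (typed 28∕28 ·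
discharged 5∕27); count-neutral; one finite 𝕋⁴ at fixed ε — R4 would close only the conditional finite-𝕋⁴ rung
`BalabanLadder.UV`, NOT the Yang–Mills mass gap (Clay); nothing about ℝ⁴ ∕ OS.
-/

set_option autoImplicit false

open MeasureTheory Set Function Finset
open scoped ENNReal

namespace Summit.QuantumFields.YangMills.Theorems.N21LowCentreEndSect1Letters

open Literature.MathematicalPhysics.QuantumFieldTheory.Balaban1983to89.T4ShellMeasure (SlotAntiConcentration)
open Literature.MathematicalPhysics.QuantumFieldTheory.Balaban1983to89.B16Sect1Wilson (Ineq16 Ineq19)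
open Summit.QuantumFields.YangMills.Theorems.N21LowCentreNumeral (half_le_recordContraction)
open Summit.QuantumFields.YangMills.Theorems.N21LowCentreNumeralBlock
  (slotAntiConcentration_restrict_of_certifiedLowCentre_defect firstOrderModel_of_sect1Letters numeral_at_sect1Letters)

/-! ## §1  The END at [LF-II] §1's letters -/

section End

variable {X : Type*} [MeasurableSpace X] {κ : Type*} [Fintype κ]

/-- ★★★ **(M1) ON THE CUT LAW ABOUT THE BACKGROUND, AT [LF-II] §1's LETTERS BY NAME.**  Part 31's END (through p587481's
defect END) in the block chart centred at the background (`m = 0`), with the first-order model SUPPLIED by the (1.2)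
expansion identity, the (1.9) coercivity row `Ineq19` and the (1.6) linear-member row `Ineq16` as hypotheses on the kept
chart, the remainder's value bound, and the located numeral SUPPLIED by the ONE clause
`16·W·d·(100M)^{d+1}·L² ≤ γ₀·(θ(1−ρ−σ))²` (core reading `U(z,0) ≤ σθ`).  Constant `3(#κ+1)(1+Q)∕(κ₀(1−ρ))`. [textbook] -/
theorem slotAntiConcentration_restrict_of_sect1Letters [Nonempty κ] (ζ : Measure X) [SFinite ζ]
    (K : X → Set (κ → ℝ)) (φ Qf lin Vt : X → (κ → ℝ) → ℝ)
    (hg : Measurable fun p : X × (κ → ℝ) =>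
      (K p.1).indicator (fun w => ENNReal.ofReal (Real.exp (-φ p.1 w))) p.2)
    {U : X × (κ → ℝ) → ℝ} (hUm : Measurable U)
    {C Env : Set (X × (κ → ℝ))} (hC : MeasurableSet C) (hEnv : MeasurableSet Env)
    {θ ρ σ κ₀ Q L γ₀ M B₃ M₀ A₀ p₀g Rk WV : ℝ} {d : ℕ}
    (hθ : 0 < θ) (hρ0 : 0 < ρ) (hρ1 : ρ < 1) (hρσ : ρ + σ ≤ 1) (hκ : 0 < κ₀) (hQ0 : 0 ≤ Q) (hL : 0 < L)
    (hd : 1 ≤ d) (hM : 0 < M) (hγ₀ : 0 < γ₀)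
    (hW : 0 ≤ 3 * B₃ * M₀ * A₀ ^ 2 * p₀g ^ 2 * Real.exp (-Rk) * (100 * M) ^ 4 + WV)
    (hK : ∀ z, Convex ℝ (K z)) (hφ : ∀ z, ConvexOn ℝ (K z) (φ z)) (h0K : ∀ z, (0 : κ → ℝ) ∈ K z)
    (hexp : ∀ z, ∀ v ∈ K z, φ z v = φ z 0 + 1 / 2 * Qf z v + lin z v + Vt z v)
    (h19 : ∀ z, ∀ v ∈ K z, Ineq19 (Qf z v) (∑ b, v b ^ 2) γ₀ d M)
    (h16 : ∀ z, ∀ v ∈ K z, Ineq16 (lin z v) B₃ M₀ A₀ p₀g Rk M)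
    (hV : ∀ z, ∀ v ∈ K z, |Vt z v| ≤ WV)
    (hU : ∀ z (a b : κ → ℝ), U (z, a) - U (z, b) ≤ L * ‖a - b‖)
    (hUc : ∀ z, U (z, 0) ≤ σ * θ)
    (hclause : 16 * (3 * B₃ * M₀ * A₀ ^ 2 * p₀g ^ 2 * Real.exp (-Rk) * (100 * M) ^ 4 + WV) * d
      * (100 * M) ^ (d + 1) * L ^ 2 ≤ γ₀ * (θ * (1 - ρ - σ)) ^ 2)
    (henv : ∀ l ∈ Icc (1 - 1 / ((Fintype.card κ : ℝ) + 1)) 1, ∀ p : X × (κ → ℝ),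
      θ * (1 - ρ) ≤ U p → U p < θ → p ∈ C → (p.1, (0 : κ → ℝ) + l • (p.2 - 0)) ∈ Env)
    (hRT : ∀ p : X × (κ → ℝ), θ * (1 - ρ) ≤ U p → U p < θ → p ∈ C → ∀ s : ℝ, 1 ≤ s →
      θ * (1 - ρ) ≤ U (p.1, (0 : κ → ℝ) + s • (p.2 - 0)) → U (p.1, (0 : κ → ℝ) + s • (p.2 - 0)) < θ →
        (p.1, (0 : κ → ℝ) + s • (p.2 - 0)) ∈ C →
          U p + κ₀ * (θ * (1 - ρ)) * (s - 1) ≤ U (p.1, (0 : κ → ℝ) + s • (p.2 - 0)))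
    (hQ : ((ζ.prod volume).withDensity fun p : X × (κ → ℝ) =>
        (K p.1).indicator (fun w => ENNReal.ofReal (Real.exp (-φ p.1 w))) p.2) (Env \ ({p | U p < θ} ∩ C))
      ≤ ENNReal.ofReal Q * ((ζ.prod volume).withDensity fun p : X × (κ → ℝ) =>
        (K p.1).indicator (fun w => ENNReal.ofReal (Real.exp (-φ p.1 w))) p.2) ({p | U p < θ} ∩ C)) :
    SlotAntiConcentration
      ((((ζ.prod volume).withDensity fun p : X × (κ → ℝ) =>
          (K p.1).indicator (fun w => ENNReal.ofReal (Real.exp (-φ p.1 w))) p.2)).restrict ({p | U p < θ} ∩ C))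
      U θ ρ (3 * ((Fintype.card κ : ℝ) + 1) * (1 + Q) / (κ₀ * (1 - ρ))) := by
  have hd0 : (0 : ℝ) < d := by exact_mod_cast hd
  have hγ : 0 < γ₀ / (2 * d * (100 * M) ^ (d + 1)) := by positivity
  have hnum := numeral_at_sect1Letters (W := 3 * B₃ * M₀ * A₀ ^ 2 * p₀g ^ 2 * Real.exp (-Rk) * (100 * M) ^ 4 + WV)
    (c₀ := σ * θ) hd hM hγ₀ hθ.le hL (half_le_recordContraction κ) hρσ le_rfl hclause
  exact slotAntiConcentration_restrict_of_certifiedLowCentre_defect ζ (m := fun _ => 0) measurable_const K φ hg hUm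
    hC hEnv hθ hρ0 hρ1 hκ hQ0 hγ le_rfl hW hL hK hφ h0K
    (fun z => firstOrderModel_of_sect1Letters hd hM hγ₀.le (hexp z) (h19 z) (h16 z) (hV z)) hU hUc hnum henv hRT hQ

end End

/-! ## §2  A6 witness: every binder of the ★★★ END discharged, the clause with equality -/

section Witness

/-- `w ↦ w₀²∕2` on `ℝ¹` is convex. [textbook] -/
theorem convexOn_halfSq_one : ConvexOn ℝ univ fun w : Fin 1 → ℝ => w 0 ^ 2 / 2 := by
  refine ⟨convex_univ, fun x _ y _ a b ha hb hab => ?_⟩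
  have hb' : b = 1 - a := by linarith
  subst hb'
  simp only [Pi.add_apply, Pi.smul_apply, smul_eq_mul]
  nlinarith [mul_nonneg (mul_nonneg ha hb) (sq_nonneg (x 0 - y 0))]

/-- **A6 WITNESS OF THE ★★★ END** (director-ym STANDING A6 RULE №189 (3)): every binder of
`slotAntiConcentration_restrict_of_sect1Letters` discharged in the kernel — exterior `X = Unit` under `dirac ()`, block
`ℝ¹`, `K = univ`, exponent `φ(w) = w₀²∕2` with the expansion `Q w = w₀²`, `lin = 0`, `Vt = 0` (`W_V = 0`); the rows as
real inequalities at `γ₀ = 1`, `d = 1`, `M = 1∕100` (so `100M = 1`), `B₃ = 1∕48`, `M₀ = A₀ = p₀(g) = 1`, `R_k = 0`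
(`Ineq19`: `½Σ_b w_b² ≤ w₀²`; `Ineq16`: `|0| < 3∕48`); statistic `U = |w₀|` (`L = 1`, core reading `0`, `σ = 0`,
`κ₀ = 1`), letter `θ = 2`, `ρ = ½`, `C = univ`, `Env = {U < 2}`, `Q = 0`; the clause
`16·(1∕16)·1·1·1 = 1 = 1·(2·½)²` WITH EQUALITY.  A satisfiability witness, not an estimate on Bałaban's measure.
[textbook] -/
theorem sect1Letters_binders_inhabited :
    SlotAntiConcentration
      ((((Measure.dirac ()).prod (volume : Measure (Fin 1 → ℝ))).withDensity
          fun p : Unit × (Fin 1 → ℝ) =>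
            (univ : Set (Fin 1 → ℝ)).indicator (fun w => ENNReal.ofReal (Real.exp (-(w 0 ^ 2 / 2)))) p.2).restrict
        ({p : Unit × (Fin 1 → ℝ) | |p.2 0| < 2} ∩ univ))
      (fun p : Unit × (Fin 1 → ℝ) => |p.2 0|) 2 (1 / 2)
      (3 * ((Fintype.card (Fin 1) : ℝ) + 1) * (1 + 0) / (1 * (1 - 1 / 2))) := by
  have hU : Measurable fun p : Unit × (Fin 1 → ℝ) => |p.2 0| := ((measurable_pi_apply 0).comp measurable_snd).abs
  have hφm : Measurable fun w : Fin 1 → ℝ => w 0 ^ 2 / 2 := ((measurable_pi_apply 0).pow_const 2).div_const 2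
  have hg : Measurable fun p : Unit × (Fin 1 → ℝ) =>
      (univ : Set (Fin 1 → ℝ)).indicator (fun w => ENNReal.ofReal (Real.exp (-(w 0 ^ 2 / 2)))) p.2 := by
    simp only [indicator_univ]
    exact (ENNReal.measurable_ofReal.comp (Real.measurable_exp.comp hφm.neg)).comp measurable_snd
  have hEnv : MeasurableSet {p : Unit × (Fin 1 → ℝ) | |p.2 0| < 2} := measurableSet_lt hU measurable_const
  have hcard : (Fintype.card (Fin 1) : ℝ) = 1 := by simp
  refine slotAntiConcentration_restrict_of_sect1Letters (Measure.dirac ()) (fun _ => univ) (fun _ w => w 0 ^ 2 / 2)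
    (fun _ w => w 0 ^ 2) (fun _ _ => 0) (fun _ _ => 0) hg hU MeasurableSet.univ hEnv
    (Env := {p : Unit × (Fin 1 → ℝ) | |p.2 0| < 2}) (σ := 0) (κ₀ := 1) (Q := 0) (L := 1) (γ₀ := 1) (M := 1 / 100)
    (B₃ := 1 / 48) (M₀ := 1) (A₀ := 1) (p₀g := 1) (Rk := 0) (WV := 0) (d := 1)
    two_pos (by norm_num) (by norm_num) (by norm_num) one_pos le_rfl one_pos le_rfl (by norm_num) one_pos ?_
    (fun _ => convex_univ) (fun _ => convexOn_halfSq_one) (fun _ => mem_univ _) ?_ ?_ ?_ ?_ ?_ ?_ ?_ ?_ ?_ ?_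
  · -- hW: `0 ≤ 3·(1/48)·1·1·1·e^0·1 + 0`
    simp
  · -- hexp: `w₀²/2 = 0²/2 + ½·w₀² + 0 + 0`
    intro _ v _
    simp only [Pi.zero_apply]
    ring
  · -- h19 (1.9) as a real inequality: `1/(2·1·1²)·Σ_b v_b² ≤ v₀²`
    intro _ v _
    unfold Ineq19
    simp only [Fin.sum_univ_one, Nat.cast_one]
    norm_num
    nlinarith [sq_nonneg (v 0)]
  · -- h16 (1.6) as a real inequality: `|0| < 3·(1/48)·…`
    intro _ v _
    unfold Ineq16
    norm_num
  · -- hV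
    intro _ v _
    simp
  · -- hU: the coordinate statistic is 1-Lipschitz for the sup norm
    intro _ a b
    have h := norm_le_pi_norm (a - b) 0
    rw [Pi.sub_apply, Real.norm_eq_abs] at h
    have h2 := abs_abs_sub_abs_le_abs_sub (a 0) (b 0)
    rw [one_mul]
    exact (le_abs_self _).trans (h2.trans h)
  · -- hUc: core reading of the background
    intro _
    simp
  · -- the clause WITH EQUALITY: `16·(3/48 + 0)·1·1²·1² = 1 ≤ 1·(2·(1 − ½ − 0))² = 1`
    norm_num
  · -- henv
    intro l hl p _ h2 _
    rw [hcard] at hl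
    have hl0 : 0 ≤ l := by have := hl.1; norm_num at this; linarith
    show |((0 : Fin 1 → ℝ) + l • (p.2 - 0)) 0| < 2
    simp only [zero_add, sub_zero, Pi.smul_apply, smul_eq_mul, abs_mul, abs_of_nonneg hl0]
    have h2' : |p.2 0| < 2 := h2
    nlinarith [abs_nonneg (p.2 0), hl.2]
  · -- hRT: `U = |w₀|` radially transversal with κ₀ = 1 on `{1 ≤ U}`
    intro p h1 _ _ r hr _ _ _
    have h1' : 1 ≤ |p.2 0| := by have h := h1; norm_num at h; exact h
    show |p.2 0| + 1 * (2 * (1 - 1 / 2)) * (r - 1) ≤ |((0 : Fin 1 → ℝ) + r • (p.2 - 0)) 0|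
    simp only [zero_add, sub_zero, Pi.smul_apply, smul_eq_mul]
    rw [abs_mul, abs_of_nonneg (by linarith : (0 : ℝ) ≤ r)]
    nlinarith [mul_nonneg (show (0 : ℝ) ≤ r - 1 by linarith) (show (0 : ℝ) ≤ |p.2 0| - 1 by linarith)]
  · -- hQ: `Env \ ({U < 2} ∩ univ) = ∅`
    have hempty : {p : Unit × (Fin 1 → ℝ) | |p.2 0| < 2} \ ({p : Unit × (Fin 1 → ℝ) | |p.2 0| < 2} ∩ univ) = ∅ := by
      ext p
      simp
    rw [hempty, measure_empty]
    exact zero_le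

end Witness

end Summit.QuantumFields.YangMills.Theorems.N21LowCentreEndSect1Letters
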